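import Mathlib
import HarnessLib
import HarnessLib.Audit
import Summits.AnomalousDissipation.Statement
import Summits.AnomalousDissipation.AnomalousDissipation.Theorems.CoherentStatesSteadyBoundedBranch
import HarnessLib.Audit.Status.Attr

/-!
Route: FrozenK41

FROZEN K41 (idea card frozen-turbulence-log-ceiling-or-steady-k41). It suffices to show X =
SteadyWitness: there is ONE smooth steady divergence-free mean-zero force f on T³ and, for
viscosities ν_j → 0, STEADY classical solutions (u_j, p_j) of NS_{ν_j} forced by f with ∫|u_j|² ≤ E
and ν_j‖∇u_j‖₂² ≥ ε > 0. The line of attack (not part of X): the u_j are nested Burgers-layer/tube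
hierarchies, each level slaved to the stagnation skeleton (slots) of the level above, of depth ≍
(3/4)·log₂(1/ν_j), closing by itself at the Kolmogorov scale η_j = ν_j^{3/4} ε^{-1/4}; with the
Kolmogorov jumps ΔU_k = (ε r_k)^{1/3} every level's layers carry the SAME gradient (ε/ν_j)^{1/2}, so
the witnesses are Kolmogorov-regular (Lip u_j ≲ (ε/ν_j)^{1/2}) with space-filling dissipation at the
last level — turbulence in which nothing moves.
Lean: (one line; verbatim CoherentStates.SteadyZerothLaw = stmt-AnomalousDissipation-0219, shared
decl) ∃ f, Torus.IsSmooth f ∧ Torus.IsDivFree f ∧ Torus.HasZeroMean f ∧ ∃ (ν : ℕ → ℝ) u p, (∀ j, 0 <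
ν j) ∧ Tendsto ν atTop (nhds 0) ∧ (∀ j, Torus.IsClassicalNSSolutionOn univ (ν j) (fun _ => f) (fun _
=> u j) (fun _ => p j)) ∧ (∃ E, ∀ j, ∫ ‖u j x‖^2 ≤ E) ∧ ∃ ε, 0 < ε ∧ ∀ j, ε ≤ ν j * Torus.gradNormSq
(u j)   (all constants under Literature.Analysis.FunctionSpaces.Torus; elaborates, Sketch.lean rc
0).
Assembly X → AnomalousDissipation (glue, ≤ 120 lines): a steady classical solution is a 1-periodic
classical solution on ℝ × T³; meanEnergy (fun _ => u_j) = ∫|u_j|² and meanDissipation ν_j (fun _ =>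
u_j) = ν_j·(eGradNormSq u_j).toReal = ν_j·gradNormSq u_j by the DISCHARGED facts
Torus.gradNormSq_eq_toReal_eGradNormSq_holds and (Cesàro mean of a constant);
Torus.isGlobalLerayHopf_of_isClassicalNSSolutionOn_holds; then
Theorems/CoherentStatesAssembly.coherent_assembly_fact.

Rationale: WHY THIS LINE.
Card frozen-turbulence-log-ceiling-or-steady-k41. Imports vortex dynamics — matched asymptotics of
strained Burgers structures, Kerr–Dold arrays, the vortex-filament log-energy bound — and elliptic
GLUING into the steady sub-line of CoherentStates (0219), replacing "continue an ECS branch" by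
"build the steady state from exact local pieces". Only steady flows permit STRUCTURE ACCOUNTING:
(S1) every high-gradient region of a steady state solves the local steady balance, whose attracting
solutions in strain α are Burgers LAYERS (thickness (ν/α)^{1/2}, dissipation ΔU²(να)^{1/2} per area)
and TUBES (dissipation αΓ²/8π per length, ν-INDEPENDENT; energy Γ²log(ℓ/δ)/4π per length)
[Frisch1995 §8.9.1 eq.(8.140) PDF p.140; MoffattKidaOhkitani1994; rigorous: GallayWayne2006 pp.2–3
(exist for all Re at small asymmetry), Maekawa2009, GallayMaekawa2010, GallayMaekawa2016]; (S2) a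
steady structure cannot be advected, so it sits in a SLOT (compressive stagnation surface /
hyperbolic stagnation curve) of the coarser field — one family per strain cell; (S3) steady tube
rows in strain are Kerr–Dold arrays [KerrDold1994; Kerr2024 p.1 and §6 p.8: counter-rotating, fed by
an upstream vorticity tail]. Hence per level D/E ≍ α/log(ℓ/δ) (tubes) or (να)^{1/2}/spacing
(layers): a single skeleton dissipates ≤ C/log(1/ν) at bounded energy (kinematic engine: vorticity
ε-concentrated on a curve of length L forces energy ≥ L·log(L/ε)/4π − O(1), JerrardSeis2016 p.6
(7b)⇒(elbd)); the ONLY steady escape is a nested hierarchy, and ΔU_k = (εr_k)^{1/3} is the unique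
self-consistent choice: δ_k ≤ r_k exactly down to r_K = η, D_K ≍ ε, ΣE_k < ∞, and every level's
layer gradient equals (ε/ν)^{1/2} (planner's check). It is to be built by gluing exact local steady
solutions (inner/outer scheme à la DavilaEtAl2022), not by convex integration; steady solutions
exist for every ν (Temam1979 Ch.II Thm 1.2) and need not be stable, so instability is irrelevant to
X.
RANKED CRUXES.
#2 SteadyLogWeak — fixed f, steady, bounded energy, ν_j‖∇u_j‖² ≥ c/log(1/ν_j): the two-level
skeleton (cells held by f + one generation of tubes on their hyperbolic stagnation curves, Γ ≍
log^{-1/2}(1/ν)) (why it might fail: no bounded-energy non-laminar steady branch may exist at all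
for a fixed f — 0221 open; the cell/tube match meets the closed-streamline Prandtl–Batchelor
cokernel; KD arrays need an upstream vorticity supply, Kerr2024 §6; sources ClearyPage2025 p.19,
KerrDold1994, GuiXieXu2026 Thm 1.1).
#3 SteadyDefectHierarchy — full depth: steady EXACT states for smooth steady forces f_j → f in L²
(power-neutral defect), bounded energy, dissipation ≥ ε; the cokernel is paid by the force (steady
specialisation of CoherentStates.CheskidovSteadyForces 0220) (why it might fail: level-k holding
forces are ≍ ε^{2/3}r_k^{-1/3}, growing with depth, so an L²-vanishing defect needs geometrically
improving gluing accuracy while Re_k falls to O(1) at η; sources Cheskidov2023 Thm 1.3,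
DavilaEtAl2022).
#4 SingleSkeletonLogCeiling (negative horn) — steady fixed-f bounded-energy families converging in
L¹ to a Lipschitz field dissipate ≤ C/log(1/ν): R2's rate is optimal without nesting, "unsteadiness
or nesting is necessary" (why it might fail: steady stacked layers or arrays denser than Kerr–Dold
may exist — KD families have the period as a free parameter; soft analysis gives only D_j ≤
‖f‖_∞‖u_j − U‖₁ + (f,U); sources JerrardSeis2016 p.6, Kerr2024 §6, decl
DeRosaDrivasInversi2024_thm19_bounded).
#5 (two rank-5 cruxes that FEED THE TARGET, added 2026-08-16 by the parallel repair seats answering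
the gate badge route.target-unreachable — 'no item concludes SteadyWitness'; rank 5 = staffed after
the informative first rungs #2–#4, not easier; each is the thesis sharpened in one direction and
each implies the target through a provable-now glue item): #5a FrozenStandingCascade (stmt-14305,
route-choice seat) — ONE fixed smooth f, steady classical states u_j with ∫|u_j|² ≤ E converging
STRONGLY in L² to a field U with ∫⟪f,U⟫ > 0: the frozen hierarchy read through its LIMIT OBJECT
(level k is ν-independent once η_j < r_k and level energies are summable ⇒ (u_j) is L²-Cauchy —
'smaller structures appear without affecting the already existing large-scale structures',
MotokiKawaharaShimizu2021 p.6, the one printed numerical steady multiscale K41 state), i.e. a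
STANDING CASCADE with ZERO Reynolds defect realised as a fixed-force vanishing-viscosity limit of
steady states — the R = 0 strengthening of SteadyWeakLimit.SteadyWeakRealisation (1303, weak
convergence) (why it might fail: (f,U) > 0 may require LOST compactness — power in the defect of a
strict subsolution rather than in D[U]; no steady rough Euler state with D[U] ≠ 0 is known to be a
viscosity limit; 2-D steady limits rigid, GuiXieXu2026 Thm 1.1; sources MotokiKawaharaShimizu2021,
ChoffrutSzekelyhidi2014 Thm 1, ConstantinETiti1994, DuchonRobert2000, BrueDeLellis2023 Q2); glue
FrozenGlue (stmt-14306, support): steady budget ν_j‖∇u_j‖² = (f,u_j)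
(Torus.IsClassicalNSSolutionOn.energy_balance_holds) → (f,U) > 0
(FluidPDE.tendsto_integral_inner_of_tendsto_lintegral_sub_sq) + tail re-indexing ⇒ SteadyWitness —
PROVED kernel-clean in the planner's scratch GlueProof.lean (≈60 lines, evidence on 14306). #5b
K41RegularSteadyWitness (stmt-14358, rbadge seat) — the target PLUS the Kolmogorov gradient cap
sup_x‖∂ᵢu_j‖ ≤ Aν_j^{-1/2}: the PRE-LIMIT fingerprint (every level's layers carry the same gradient
(ε/ν)^{1/2}; space-filling, zero-intermittency dissipation; excludes laminar and single-skeleton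
states; steady analogue of BoussinesqOctaves.ExactTower 1451) (why it might fail: the cap bounds all
normalised derivative moments uniformly in Re against measured intermittency, Frisch1995 p.117,
ElsingaIshiharaHunt2020 §4; strained steady layers roll up, BeronovKida1996); glue
K41RegularImpliesSteady (stmt-14359, support, 2 lines: drop the cap). 5a and 5b are logically
independent sharpenings (compactness + power of the limit vs. uniform pre-limit regularity); their
conjunction is the honest full FK41 thesis, and a refutation of either kills the frozen MECHANISM in
that direction without killing the target.
Ladder: #5a ⇒ Target (FrozenGlue), #5b ⇒ Target (K41RegularImpliesSteady); Target ⇒ #2 and Target ⇒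
#3 trivially (f_j := f); #4 ∧ #2 pin D·log(1/ν) ≍ 1 on single skeletons. Target (rank 0)
SteadyWitness = 0219 (shared with CoherentStates, SteadyWeakLimit's GlueSteadyZerothLaw consequent);
support SteadyBoundedBranch = 0221 (first rung, shared); Assembly (rank 1) SteadyWitness →
AnomalousDissipation (glue; both bridge facts are discharged in tree:
Torus.isGlobalLerayHopf_of_isClassicalNSSolutionOn_holds,
Torus.gradNormSq_eq_toReal_eGradNormSq_holds; then
Theorems/CoherentStatesAssembly.coherent_assembly_fact). DECIDING THEOREM (2026-08-16): closes (hW :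
SteadyWitness) (hA : Assembly) := hA hW — minimal and path-neutral: the target item closes through
EITHER glue chain (#5a or #5b) or through any sibling route settling the shared decl 0219, and the
four unused hypotheses of the transition-era closes (#2, #3, #4, 0221 — one of them the NEGATIVE
horn) no longer stand between the cruxes and the Statement.
KILL CRITERIA.
A theorem "steady + fixed smooth f + bounded energy ⇒ ν‖∇u‖² ≤ Cν^a for some a > 0" refutes #2 and
closes the route; CoherentStates.SteadyNeg (0222) proved closes it; #3 refuted (even L²-convergent
steady forces cannot hold O(1) steady dissipation at bounded energy) closes the FK41 horn — #2/#4
then migrate to route Neg as rate statements; #4 proved together with L¹-precompactness (Lipschitz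
limits) of steady bounded-energy families closes it. #5a refuted — e.g. 'strong L² limits U of
bounded-energy steady fixed-f families are work-free, (f,U) = 0' (a steady Onsager/compactness
rigidity) — kills the frozen R = 0 horn (lost compactness is route SteadyWeakLimit's X, not this
one); #5b refuted — 'steady + fixed f + bounded energy + cap ‖∂u‖ ≤ Aν^{-1/2} ⇒ ν‖∇u‖² → 0' (an
Onsager-endpoint rigidity for steady states) — kills the non-intermittent mechanism; BOTH refuted
retires the FK41 horn: the route closes or is re-thesised on its SLC horn (#4 → Neg as a rate
statement, #2 as the matching floor).
NOT DECOMPOSED YET.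
Literature definitions for the Burgers vortex/layer in linear strain and for Kerr–Dold arrays
(definition request filed against #2); the K41 fingerprint of the witnesses (Lip u_j ≤
C(ε/ν_j)^{1/2}, S₂(r) ≤ C r^{2/3}) as a sharpened target; the nesting step (level k hosts level k+1
with uniform constants), the L²-Cauchy property in the depth and the uniform gradient cap = the
future glued split of #5a/#5b (HierarchyAnsatz with residual estimates + steady linear solvability
around it + level-wise bookkeeping) once #2 moves — until then 5a/5b are attacked only through
#2/#3; the structure of the frozen limit U (bounded, B^{1/3}_{3,∞}-exact, Duchon–Robert measure D[U]
= ε·Lebesgue) as the common sharpening of 5a ∧ 5b; the two-level gluing itself (ansatz + linear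
invertibility) = future split of #2; kit numerics (continue steady 3-D Taylor–Green/ABC-forced
branches, report D·log(1/ν) and a skeleton census) as evidence on #2.
CHEAPEST FALSIFIER.
Continue one 3-D steady branch with a fixed smooth force (Taylor–Green- or detuned-ABC-forced steady
states) to Re ~ 10³–10⁴ by Newton–Krylov continuation and report D(ν)·log(1/ν) with a skeleton
census: D·log(1/ν) → 0 on every bounded-energy branch found (or no bounded-energy branch at all)
retires the mechanism of #2. Cheaper still (pencil): can ONE Burgers tube of circulation Γ ≍
log^{-1/2}(1/ν) sit steadily on a hyperbolic stagnation line of a Taylor–Green cell without an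
upstream vorticity supply? Kerr2024 §6 says KD arrays need one; if that supply must be injected at
the fine scale with O(1) amplitude, a fixed smooth f cannot provide it and #2 dies at the drawing
board. For #5a/#5b (pencil/kit, cheapest first): on the MotokiKawaharaShimizu2021 steady branch — or
any 3-D steady branch continued under CHEAPEST FALSIFIER above — test FREEZING and the CAP
quantitatively: is Σ_{|k|≤K}|û_ν(k) − û_{ν/2}(k)|² → 0 at fixed K as ν ↓ (L²-Cauchy large scales)
and does max|∇u|·ν^{1/2} stay bounded while (f,u_ν) stays bounded below? Drifting large scales
retire 5a in favour of SteadyWeakLimit's subsolution picture; growing max|∇u|ν^{1/2} (intermittent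
cores) retires 5b in favour of a tube-dominated hierarchy.

Novelty: NOVELTY (planner, 2026-08-15; searches run BEFORE this claim — searchd local index DOWN (rc 75) and
OpenAlex/arXiv HTTP 429 during the pass, so: zbMATH + Crossref cascade, `lit vsearch`, `lit galaxy
search --star all`, `lit frontier AnomalousDissipation --since 2021`, `lit bridges
AnomalousDissipation --cross any`, and `lit read` of the held texts):
 zbMATH "Burgers vortex Navier-Stokes stability" (20: GallayWayne2006 = arXiv:math/0503353,
GallayMaekawa2010 = arXiv:1002.2489, Maekawa2009, Maekawa JMFM 2011, ProchazkaPullin JFM 363,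
BeronovKida 1995/1997 layer stability, Ohkitani PRIMS 2004 survey, GallayMaekawa2016 =
arXiv:1610.08384); zbMATH "periodic steady vortices stagnation point flow" (KerrDold1994); zbMATH
"vortex filament conjecture Euler" (JerrardSeis2016 = arXiv:1603.00227, DavilaEtAl2022 =
arXiv:2007.00606, Averkiou–Musso 2026, Donati–Lacave–Miot 2024); zbMATH "Prandtl-Batchelor steady
Navier-Stokes vanishing viscosity" (GuiXieXu2026 = arXiv:2601.08647); Crossref "Stretched vortices
sinews of turbulence" (MoffattKidaOhkitani1994); vsearch "steady forced NS small viscosity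
dissipation ≥ c/log Re; Burgers vortices; tube energy logarithmic" (Frisch1995 pp.192–197,
DoeringGibbon1995, FMRT2001 — none on steady ceilings); galaxy --star all "Burgers vortex" (49 rows:
Davidson, Saffman Vortex Dynamics, Hunt–Vassilicos, Frisch; nothing on steady dissipation ceilings).
 READ: Frisch1995 PDF pp.139–141 (§8.9.1: Burgers vortex (8.140), MKO 'sinews', Jiménez Re_Γ =
150–400); Je  [refs: math/0503353, 1002.2489, 1610.08384, 1603.00227, 2007.00606, 2601.08647, 2409.09695, 2502.06475, GallayWayne2006, GallayMaekawa2010, Maekawa2009, GallayMaekawa2016, KerrDold1994, JerrardSeis2016, DavilaEtAl2022, GuiXieXu2026, MoffattKidaOhkitani1994, Frisch1995, DoeringGibbon1995, FMRT2001, Kerr2024, ClearyPage2025]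

Barriers (technique_class: steady-structure-accounting burgers-skeleton gluing): - technique_class: steady-structure-accounting burgers-skeleton gluing
- Literature.Barriers.AnomalousDissipation.Cheskidov2023_thm13_not_forceRobustNoAnomaly: APPLIES to
R4 (SingleSkeletonLogCeiling is a Neg-type upper bound over a class of families) — an energy-method
proof stable under o(1) ν-dependent time-periodic force changes would prove ForceRobustNoAnomaly,
refuted by Cheskidov2023 Thm 1.3. Evasion: R4's intended proof uses EXACT STEADINESS of solution and
force at every step (slots (S2), Kerr–Dold spacing (S3), Burgers local balance) — scope caveat (a)
of the barrier; honest form: not evaded by construction, the bet is that steadiness + L¹-convergence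
to a Lipschitz field is genuinely stronger than the time-periodic class. R2/R3/Target are witness
statements, outside the blocked class.
- Literature.Barriers.AnomalousDissipation.BrueDeLellis2023_noAnomaly_beforeEulerSingularity (and
…Narrow): finite-window, fixed smooth DATA, classical Euler limit — EVADED: the witnesses are steady
states (their own long-time average) with ν-dependent data u_j itself and no uniform-in-ν smooth
Euler limit (the frozen hierarchy is Onsager-critical, Lip u_j ≍ ν_j^{-1/2}).
- Literature.Barriers.AnomalousDissipation.DrivasEyink2019_lemma1: uniform L³_t B^σ_{3,∞}, σ > 1/3 ⇒
no anomaly — NOT in the class: FK41 witnesses sit exactly at the Onsager exponent (S₂(r) ≍ r^{2/3},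
S₃(r) ≍ r·log(1/r) from sheets at all levels), and R2's two-level tubes have |u| ≍ Γ/r near cores
(not uniformly B^σ,

History (route lifecycle, newest last):
- 2026-08-16T03:41:19Z · AUTO-CRUX (backfill): SteadyWitness — hypotheses of the deciding theorem that nothing in the route derives are cruxes (operator:999:586464)
- 2026-08-22T06:34:31Z · DORMANT — reconciler: no traction for 5.1 d (last activity item-evidence-added at 2026-08-17T02:39:35Z); parked, not closed — `ledger route dormant route-AnomalousDissipa (operator:999:3280991)
- 2026-08-31T11:38:24Z · REACTIVATED (open) — reconciler: reactivated — activity statement-checked at 2026-08-31T10:30:37Z after parking at 2026-08-22T06:34:31Z (operator:999:3261599)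

sub-problem: AnomalousDissipation · status: open · opened planner-plancard-AnomalousDissipation-Anomalo-041808b0-0 2026-08-15T10:53:47Z · rev 8 · ledger route-AnomalousDissipation-FrozenK41
GENERATED by the gate from the ledger (D-0016/17). Provers cite these decls: `theorem foo : Summit.AnomalousDissipation.AnomalousDissipation.Theses.FrozenK41.<Decl> := …` in Summits/AnomalousDissipation/AnomalousDissipation/Theorems/<Name>.lean.
-/

namespace Summit.AnomalousDissipation.AnomalousDissipation.Theses.FrozenK41

open scoped BigOperators Topology Manifold Classical MeasureTheory ProbabilityTheory Matrix InnerProductSpace ComplexConjugate ContinuousMap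
open Filter Set Function TopologicalSpace MeasureTheory

attribute [summit_statement] _root_.AnomalousDissipation

open Literature.Turb

/-- item stmt-AnomalousDissipation-0219 · crux (kind.auto-crux: conjecture-grade) · rank 0 · open · by planner
why it might fail: Steadiness + FIXED f may force D_j→0: D_j=(f,u_j)→(f,U) along weak limits, =0 once U is a defect-free Onsager-regular steady Euler state; no 3-D bounded-energy fixed-f steady branch with D↛0 known; 2-D steady inviscid limits rigid (GuiXieXu2026 Thm 1.1); even steady f^ν open (BrueDeLellis2023 Q2).
sources: BrueDeLellis2023 = arXiv:2207.06301 p.5 Questions 1-2 (force independent of ν / of time: open), GuiXieXu2026 = arXiv:2601.08647 p.4 Thm 1.1 + Rem 1.4 (2-D steady vanishing-viscosity limits are constant-vorticity flows; force o(ν)), decl Literature.Barriers.AnomalousDissipation.AlexakisDoering2006_energyDissipationBound (2-D/x₃-invariant: D ≲ Re^{-1/2}), Temam1979 Ch.II Thm 1.2 (steady solutions exist ∀ν; only ‖∇u‖ ≤ ‖f‖_{H⁻¹}/ν, no ν-uniform energy bound), FoiasManleyRosaTemam2001 p.101 (12.38)-(12.39) (steady energy identity ν‖∇u‖² = (f,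u))
Elliptic reformulation: f = P(u_j·∇u_j) − ν_jΔu_j with f fixed and smooth means the high modes of
P(u_j⊗u_j) are exactly balanced by viscosity — a steady cascade. Existence of steady solutions ∀ν:
Leray–Schauder (Temam1979 Ch. II Thm 1.2), a-priori only ‖∇u‖ ≤ ‖f‖_{H⁻¹}/ν. Refutation (#5) would
show unsteadiness is necessary. -/
@[route_item "route-AnomalousDissipation-FrozenK41", crux]
def SteadyWitness : Prop :=
  ∃ f : UnitAddTorus (Fin 3) → EuclideanSpace ℝ (Fin 3), Literature.Analysis.FunctionSpaces.Torus.IsSmooth f ∧ Literature.Analysis.FunctionSpaces.Torus.IsDivFree f ∧ Literature.Analysis.FunctionSpaces.Torus.HasZeroMean f ∧ ∃ (ν : ℕ → ℝ) (u : ℕ → UnitAddTorus (Fin 3) → EuclideanSpace ℝ (Fin 3)) (p : ℕ → UnitAddTorus (Fin 3) → ℝ), (∀ j, 0 < ν j) ∧ Filter.Tendsto ν Filter.atTop (nhds 0) ∧ (∀ j, Literature.Analysis.FunctionSpaces.Torus.IsClassicalNSSolutionOn Set.univ (ν j) (fun _ => f) (fun _ => u j) (fun _ => p j)) ∧ (∃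 E : ℝ, ∀ j, MeasureTheory.integral MeasureTheory.volume (fun x => ‖u j x‖ ^ 2) ≤ E) ∧ ∃ ε : ℝ, 0 < ε ∧ ∀ j, ε ≤ ν j * Literature.Analysis.FunctionSpaces.Torus.gradNormSq (u j)

/-- item stmt-AnomalousDissipation-1214 · crux · rank 2 · open · by planner
why it might fail: No bounded-energy steady branch with D≳1/log(1/ν) may exist for FIXED f: a forced pure-strain line holds STEADY tube arrays only for 19≲Re≲45 and tubes weaken their own core strain (AndreottiDouadyCouder1997); KD arrays need upstream vorticity f cannot feed (Kerr2024 §6); Prandtl–Batchelor cokernel.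
sources: AndreottiDouadyCouder1997 = doi:10.1007/bfb0105032 (held book:boratav1997 PDF p.103: Re_c = 19±1 steady → steady vortex array → chaotic at Re ≈ 45; p.104: vortices retro-act on the stretching, KD/Burgers imposed-strain models fail at high Re), Kerr2024 = arXiv:2409.09695 §6 p.8 (steady periodic vortices require an upstream supply of vorticity; vast families, period free), KerrDold1994 (JFM 276, 307-325), GallayWayne2006 = arXiv:math/0503353 pp.2-3 (asymmetric Burgers vortices: all Re only at small asymmetry), GuiXieXu2026 = arXiv:2601.08647 Thm 1.1 (closed-streamline rigidity of steady inviscid limits, 2-D), ClearyPage2025 = arXiv:2502.06475 p.19 L13-18 (2-D Kolmogorov ECS/RPO branches: D ~ Re, Re^{-1/2}, Re^{-1}; none bounded-energy with D ≳ 1/log)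
[crux] STEADY LOG-WEAK LAW: ∃ ONE fixed smooth steady div-free mean-zero f on T³, ν_j → 0 with ν_j ≤
1/2, STEADY classical solutions (u_j,p_j) of NS_{ν_j} forced by f, ∫|u_j|² ≤ E, and c > 0 with
ν_j‖∇u_j‖² ≥ c/log(1/ν_j) for all j. Intended witness = the TWO-LEVEL frozen skeleton: a genuinely
3-D cellular flow U₀ held by f (hyperbolic stagnation curves with axial stretching α ≍ 1) plus one
generation of Burgers tubes glued on those curves (Kerr–Dold-type counter-rotating arrays where the
slot is a stagnation surface), circulation Γ_j ≍ log^{-1/2}(1/ν_j) so that tube energy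
Γ²L·log(ℓ/δ)/4π = O(1) while tube dissipation αΓ²L/8π ≍ 1/log(1/ν_j); power balance ν‖∇u‖² = (f,u_j)
is met by the O(1/log) strain work of U₀ on the tubes. Exponentially better than every computed
fixed-force branch (ECS: O(ν); 2-D: ≤ Re^{-1/2}). Implies CoherentStates.SteadyBoundedBranch (0221).
[deps: SteadyBoundedBranch] [difficulty: XL] -/
@[route_item "route-AnomalousDissipation-FrozenK41"]
def SteadyLogWeak : Prop :=
  ∃ f : UnitAddTorus (Fin 3) → EuclideanSpace ℝ (Fin 3), Literature.Analysis.FunctionSpaces.Torus.IsSmooth f ∧ Literature.Analysis.FunctionSpaces.Torus.IsDivFree f ∧ Literature.Analysis.FunctionSpaces.Torus.HasZeroMean f ∧ ∃ (ν : ℕ → ℝ) (u : ℕ → UnitAddTorus (Fin 3) → EuclideanSpace ℝ (Fin 3)) (p : ℕ → UnitAddTorus (Fin 3) → ℝ), (∀ j, 0 < ν j ∧ ν j ≤ 1 / 2) ∧ Filter.Tendsto ν Filter.atTop (nhds 0) ∧ (∀ j, Literature.Analysis.FunctionSpaces.Torus.IsClassicalNSSolutionOn Set.univ (ν j) (fun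 _ => f) (fun _ => u j) (fun _ => p j)) ∧ (∃ E : ℝ, ∀ j, MeasureTheory.integral MeasureTheory.volume (fun x => ‖u j x‖ ^ 2) ≤ E) ∧ ∃ c : ℝ, 0 < c ∧ ∀ j, c / Real.log (1 / ν j) ≤ ν j * Literature.Analysis.FunctionSpaces.Torus.gradNormSq (u j)

/-- item stmt-AnomalousDissipation-1215 · crux · rank 3 · open · by planner
why it might fail: Steady ν-dependent forcing with O(1) dissipation is open even without f_j→f (BrueDeLellis2023 Q2); known anomalies (ibid. Thm 1.1, Cheskidov2023 Thm 1.3) move energy in TIME, a steady state balances each scale exactly; holding forces ≍ε^{2/3}r_k^{-1/3} grow with depth, Re_k=O(1) at η: no asymptotics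
sources: BrueDeLellis2023 = arXiv:2207.06301 p.4 Thm 1.1 (f^ν time-dependent, sup_m ‖f^{ν_m}‖_{C([0,1];C^α)} < ∞), p.5 Question 2 (time-independent forces: open), Cheskidov2023 = arXiv:2311.04182 Thm 1.3 (time-periodic u^ν, forces f^ν → f); decl Literature.Analysis.FluidPDE.cheskidov_time_periodic_anomaly (was cited under the stale name Literature.Turb.…), DavilaEtAl2022 = arXiv:2007.00606 (inner/outer gluing for concentrated vorticity; inviscid, travelling), GallayMaekawa2010 = arXiv:1002.2489; Maekawa2009 (Burgers vortices exist/stable only with quantified Re-dependence), JerrardSeis2016 = arXiv:1603.00227 p.6 ((7b) ⇒ tube energy ≥ L log(L/ε)/4π − O(1)), AndreottiDouadyCouder1997 = doi:10.1007/bfb0105032 p.104/p.107 (strain cannot be imposed: vorticity retro-acts on stretching)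
[crux] FULL-DEPTH FROZEN HIERARCHY WITH A POWER-NEUTRAL FORCE DEFECT: ∃ smooth f, ν_j → 0, smooth
div-free mean-zero steady forces f_j with ‖f_j − f‖_{L²} → 0, and STEADY classical solutions
(u_j,p_j) of NS_{ν_j} forced by f_j with ∫|u_j|² ≤ E and ν_j‖∇u_j‖² ≥ ε > 0. The steady
specialisation of CoherentStates.CheskidovSteadyForces (0220: time-periodic u_j) and the natural
output of the gluing construction: nest Burgers layers/tubes of jumps ΔU_k = (εr_k)^{1/3} on the
stagnation skeleton of level k−1, r_k = 2^{-k}, down to r_K = η_j = ν_j^{3/4}ε^{-1/4} (layer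
condition δ_k = (ν/α_k)^{1/2} ≤ r_k holds exactly to η; D_K ≍ ε; Σ_k E_k < ∞; every level's layer
gradient = (ε/ν_j)^{1/2}), solve the steady equations exactly and put the gluing mismatch into the
force; L²-smallness of the defect makes it do no work asymptotically ((f_j − f, u_j) ≤ ‖f_j −
f‖₂E^{1/2} → 0), so all power ε comes from f. Target ⇒ this (f_j := f). [deps: SteadyLogWeak]
[difficulty: open-problem] -/
@[route_item "route-AnomalousDissipation-FrozenK41"]
def SteadyDefectHierarchy : Prop :=
  ∃ (f : UnitAddTorus (Fin 3) → EuclideanSpace ℝ (Fin 3)) (ν : ℕ → ℝ) (fs : ℕ → UnitAddTorus (Fin 3) → EuclideanSpace ℝ (Fin 3)) (u : ℕ → UnitAddTorus (Fin 3) → EuclideanSpace ℝ (Fin 3)) (p : ℕ → UnitAddTorus (Fin 3) → ℝ), Literature.Analysis.FunctionSpaces.Torus.IsSmooth f ∧ (∀ j, 0 < ν j) ∧ Filter.Tendsto ν Filter.atTop (nhds 0) ∧ (∀ j, Literature.Analysis.FunctionSpaces.Torus.IsSmooth (fs j) ∧ Literature.Analysis.FunctionSpaces.Torus.IsDivFree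 (fs j) ∧ Literature.Analysis.FunctionSpaces.Torus.HasZeroMean (fs j)) ∧ Filter.Tendsto (fun j => MeasureTheory.eLpNorm (fs j - f) 2 MeasureTheory.volume) Filter.atTop (nhds 0) ∧ (∀ j, Literature.Analysis.FunctionSpaces.Torus.IsClassicalNSSolutionOn Set.univ (ν j) (fun _ => fs j) (fun _ => u j) (fun _ => p j)) ∧ (∃ E : ℝ, ∀ j, MeasureTheory.integral MeasureTheory.volume (fun x => ‖u j x‖ ^ 2) ≤ E) ∧ ∃ ε : ℝ, 0 < ε ∧ ∀ j, ε ≤ ν j * Literature.Analysis.FunctionSpaces.Torus.gradNormSq (u j)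

/-- item stmt-AnomalousDissipation-1216 · crux · rank 4 · open · by planner
why it might fail: Hypotheses do not cap jumps: N strained layers, δ=(ν/α)^{1/2}, ΔU≍(E/Nδ)^{1/2} keep energy ≤E and L¹-defect NΔUδ→0 yet dissipate νNΔU²/δ≍αE=O(1); the ceiling rests on unproved slot/spacing selection (S2)/(S3) (KD-type arrays: vast families, free period — Kerr2024 §6) and on (f,U)=0 for the limit U.
sources: Kerr2024 = arXiv:2409.09695 §6 p.8 (vast families of steady periodic vortices; upstream supply; period free); KerrDold1994, JerrardSeis2016 = arXiv:1603.00227 p.6 (7b) ⇒ (elbd), p.11 (log-energy lower bound for concentrated vorticity: the tube half of the ceiling), BeronovKida1996 (Phys. Fluids 8: Burgers vortex LAYER linearly unstable to 2-D long waves — layers vs arrays selection is dynamical, not kinematic), AndreottiDouadyCouder1997 = doi:10.1007/bfb0105032 p.103 (observed array spacing ≈ gap L: one data point for (S3)), decl Literature.Barriers.AnomalousDissipation.DeRosaDrivasInversi2024_thm19_bounded (bounded forced families: dissipation measure ≪ H^d — qualitative thin-support version, no rate, needs L^∞ bounds this statement drops), decl Literature.Barriers.AnomalousDissipation.Cheskidov2023_thm13_not_forceRobustNoAnomaly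 (an energy-method proof robust under o(1) time-periodic force changes is impossible; scope caveat (a): steadiness-based arguments not blocked)
[crux] SINGLE-SKELETON LOG-CEILING (negative horn, the SLC side of the card's steady dichotomy): for
every fixed smooth steady div-free mean-zero f, every Lipschitz field U, and every family of STEADY
classical solutions (u_j,p_j) of NS_{ν_j} forced by f with ν_j → 0 (ν_j ≤ 1/2), ∫|u_j|² ≤ E and u_j
→ U in L¹(T³), there is C with ν_j‖∇u_j‖² ≤ C/log(1/ν_j) for all j. 'Converges in L¹ to a Lipschitz
field' is the typeable surrogate of 'one skeleton level on an O(1) background': it holds for the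
two-level tube/layer witnesses of SteadyLogWeak (tube fields are O(Γ/r), Γ → 0; layers have L¹-mass
ΔU·ν^{1/2}) and FAILS for the frozen K41 hierarchy (‖u_j − U₀‖₁ ≍ ΔU_1 = O(1), rough limit), so it
separates the horns. Mechanism of proof: steadiness ⇒ structures sit in slots of U (S2) at Kerr–Dold
spacing (S3) with Burgers cores δ² = ν/α, α ≤ Lip U; tubes then obey D/E ≤ α/(2 log(ℓ/δ)) via the
filament log-energy bound (JerrardSeis2016), layers D ≍ ΔU²(να)^{1/2}; both ≤ C/log(1/ν). With
SteadyLogWeak it pins D·log(1/ν) ≍ 1 for single skeletons: unsteadiness OR nesting is necessary for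
the zeroth law. Qualitative bounded-family version already follows from decl
DeRosaDrivasInversi2024_thm19_bo -/
@[route_item "route-AnomalousDissipation-FrozenK41"]
def SingleSkeletonLogCeiling : Prop :=
  ∀ f : UnitAddTorus (Fin 3) → EuclideanSpace ℝ (Fin 3), Literature.Analysis.FunctionSpaces.Torus.IsSmooth f → Literature.Analysis.FunctionSpaces.Torus.IsDivFree f → Literature.Analysis.FunctionSpaces.Torus.HasZeroMean f → ∀ (U : UnitAddTorus (Fin 3) → EuclideanSpace ℝ (Fin 3)) (Λ : NNReal), LipschitzWith Λ U → ∀ (ν : ℕ → ℝ) (u : ℕ → UnitAddTorus (Fin 3) → EuclideanSpace ℝ (Fin 3)) (p : ℕ → UnitAddTorus (Fin 3) → ℝ), (∀ j, 0 < ν j ∧ ν j ≤ 1 / 2) → Filter.Tendsto ν Filter.atTop (nhds 0) → (∀ j, Literature.Analysis.FunctionSpaces.Torus.IsClassicalNSSolutionOn Set.univ (ν j) (fun _ => f) (fun _ => u j) (fun _ => p j)) → (∃ E : ℝ, ∀ j, MeasureTheory.integral MeasureTheory.volume (fun x => ‖u j x‖ ^ 2) ≤ E) → Filter.Tendsto (fun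 j => MeasureTheory.integral MeasureTheory.volume (fun x => ‖u j x - U x‖)) Filter.atTop (nhds 0) → ∃ C : ℝ, ∀ j, ν j * Literature.Analysis.FunctionSpaces.Torus.gradNormSq (u j) ≤ C / Real.log (1 / ν j)

/-- item stmt-AnomalousDissipation-14305 · crux · rank 5 · open · by planner
why it might fail: R = 0 may be impossible: fixed-f steady families with (f,U) > 0 may need LOST compactness (power in the Reynolds defect, not in D[U]); no steady L²/C⁰ Euler state with D[U] ≠ 0 is known to be a viscosity limit; 2-D steady limits are rigid (GuiXieXu2026 Thm 1.1); MKS2021 is numerics, Ra ≤ 10^7.4.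
sources: MotokiKawaharaShimizu2021 = doi:10.1017/jfm.2020.978 = arXiv:2004.06868 p.6 (small scales appear 'without affecting the already existing large-scale structures'), p.7 (E = 1.5ε^{2/3}k^{-5/3}, k-space flux balances ε): numerical steady multiscale state (RB, walls), ChoffrutSzekelyhidi2014 = arXiv:1401.4301 Thm 1 (L^∞ stationary weak Euler flows: limit class non-empty), ConstantinETiti1994 = doi:10.1007/bf02099744 (B^α_{3,∞}, α > 1/3 ⇒ no anomalous work; U must be Onsager-critical), DuchonRobert2000 (Nonlinearity 13, 249-255: D[u], local energy balance; steady forced: ∫D[U] = (f,U)), GuiXieXu2026 = arXiv:2601.08647 Thm 1.1 + Rem 1.4 (2-D steady vanishing-viscosity limits rigid), BrueDeLellis2023 = arXiv:2207.06301 p.5 Question 2 (time-independent force: open)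
[crux] FROZEN STANDING CASCADE — the FK41 horn read through its limit object; it concludes the
target through the glue item FrozenGlue (route-choice repair 2026-08-16: target-unreachable). ∃ ONE
smooth steady div-free mean-zero f, ν_j → 0+, STEADY classical NS_{ν_j} states (u_j,p_j) forced by f
with ∫|u_j|² ≤ E, and a field U ∈ L²(T³) with ‖u_j − U‖_{L²} → 0 (STRONG convergence) and ∫⟪f,U⟫ > 0
(the frozen limit still absorbs power). Why this is the thesis' own deciding statement: in the
nested Burgers-layer/tube hierarchy level k is ν-independent once η_j = ν_j^{3/4}ε^{-1/4} < r_k and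
the level energies (εr_k)^{2/3}·(volume fraction) are summable, so (u_j) is Cauchy in L² — 'smaller
and stronger vortex structures appear without affecting the already existing large-scale structures'
(MotokiKawaharaShimizu2021 p.6, the one printed (numerical, Ra ≤ 10^{7.4}) steady multiscale K41
state: E = 1.5ε^{2/3}k^{-5/3}, flux = dissipation, p.7-8) — and (f,U) = lim (f,u_j) = lim ν_j‖∇u_j‖²
= ε. What it adds to the target (and to SteadyWeakLimit.SteadyWeakRealisation, stmt 1303, which asks
only WEAK convergence): strong compactness kills the Reynolds defect — u_j⊗u_j → U⊗U in L¹ and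
ν_j∫⟪u_j,Δw⟫ -/
@[route_item "route-AnomalousDissipation-FrozenK41"]
def FrozenStandingCascade : Prop :=
  ∃ f : UnitAddTorus (Fin 3) → EuclideanSpace ℝ (Fin 3), Literature.Analysis.FunctionSpaces.Torus.IsSmooth f ∧ Literature.Analysis.FunctionSpaces.Torus.IsDivFree f ∧ Literature.Analysis.FunctionSpaces.Torus.HasZeroMean f ∧ ∃ (ν : ℕ → ℝ) (u : ℕ → UnitAddTorus (Fin 3) → EuclideanSpace ℝ (Fin 3)) (p : ℕ → UnitAddTorus (Fin 3) → ℝ) (U : UnitAddTorus (Fin 3) → EuclideanSpace ℝ (Fin 3)), (∀ j, 0 < ν j) ∧ Filter.Tendsto ν Filter.atTop (nhds 0) ∧ (∀ j, Literature.Analysis.FunctionSpaces.Torus.IsClassicalNSSolutionOn Set.univ (ν j) (fun _ => f) (fun _ => u j) (fun _ => p j)) ∧ (∃ E : ℝ, ∀ j, MeasureTheory.integral MeasureTheory.volume (fun x => ‖u j x‖ ^ 2) ≤ E) ∧ MeasureTheory.MemLp U 2 MeasureTheory.volume ∧ Filter.Tendsto (fun j => MeasureTheory.eLpNorm (u j -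 U) 2 MeasureTheory.volume) Filter.atTop (nhds 0) ∧ 0 < MeasureTheory.integral MeasureTheory.volume (fun x => inner ℝ (f x) (U x))

/-- item stmt-AnomalousDissipation-14358 · crux · rank 5 · open · by planner
why it might fail: Adds a uniform cap |∂u_j|≤Aν_j^{-1/2} to the open target: bounds all normalised derivative moments in Re, against measured intermittency (flatness ∼R^ξ₄, Frisch1995 p.117; ε_max/⟨ε⟩ ∼Re_λ^1.3, arXiv:2010.13550 §4); strained steady layers roll up (BeronovKida1996) into tubes, cores Γα/ν ≫ ν^{-1/2}.
sources: ElsingaIshiharaHunt2020 = arXiv:2010.13550 = doi:10.1098/rspa.2020.0591 §4 PDF p.10 (ε_max/⟨ε⟩ grows as a Re_λ power with exponent drifting 1 → 7/4, ≈1.3 for 400 < Re_λ < 1100, DNS-consistent), Frisch1995 = book:frisch1995-turbulence-legacy-n-kolmogorov PDF p.115 eq.(8.68) S_n ∼ R^{ξ_n}; p.117 (derivative flatness ≈ 6 at R_λ = 200 → 20–40 at R_λ ≈ 3000); p.140 §8.9.1 (Burgers vortex in strain, MoffattKidaOhkitani1994), MeneveauSreenivasan1991 = doi:10.1017/s0022112091001830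 (multifractal dissipation), BeronovKida1996 = doi:10.1063/1.868879 (Burgers vortex LAYER linearly unstable to 2-D long waves: layers roll up into tubes), decl Summit.AnomalousDissipation.AnomalousDissipation.Theses.BoussinesqOctaves.ExactTower (stmt-1451, time-periodic K41-capped sibling) and .TowerNoAnomaly (stmt-1452, its negative horn), BrueDeLellis2023 = arXiv:2207.06301 p.5 Question 2 (time-independent forces: open); decl Literature.Barriers.AnomalousDissipation.DrivasEyink2019_lemma1 (uniform B^σ_{3,∞}, σ > 1/3 ⇒ no anomaly; the cap sits at σ = 1/3 in L^∞-gradient form, outside the class)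
[crux] FROZEN K41 WITNESS (the sharpened target of the card, now the item that feeds the target):
ONE fixed smooth steady div-free mean-zero f on T³, ν_j → 0, STEADY classical solutions (u_j,p_j) of
NS_{ν_j} forced by f, ∫|u_j|² ≤ E, ν_j‖∇u_j‖² ≥ ε > 0, AND the Kolmogorov gradient cap sup_x
‖∂ᵢu_j(x)‖ ≤ A ν_j^{-1/2} for all j, i — the fingerprint of the frozen hierarchy, in which every
level's Burgers layers carry the same gradient (ε/ν_j)^{1/2} (ΔU_k = (εr_k)^{1/3}, δ_k =
(ν/α_k)^{1/2}, down to η = ν^{3/4}ε^{-1/4}). With ε ≤ ν_j‖∇u_j‖² the cap forces SPACE-FILLING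
dissipation: vol{Σᵢ‖∂ᵢu_j‖² ≥ ε/(2ν_j)} ≥ ε/(6A²) (Chebyshev from above), i.e. zero intermittency —
every normalised derivative moment S_n ≤ (3A²/ε)^{(n−2)/2} uniformly in Re; it excludes all laminar
branches (gradients ∼ ν⁻¹) and all single-skeleton states (Burgers tube cores Γα/ν). Steady analogue
of BoussinesqOctaves.ExactTower (stmt-1451, time-periodic on a geometric viscosity ladder with the
same cap ‖∂ᵢu‖ ≤ A/√ν; its negative TowerNoAnomaly stmt-1452) without ladder/increment clauses;
implies the target by K41RegularImpliesSteady (drop the cap). A refutation 'steady + fixed f +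
bounded energy + cap ⇒ ν_j‖∇u_j‖² → 0 -/
@[route_item "route-AnomalousDissipation-FrozenK41"]
def K41RegularSteadyWitness : Prop :=
  ∃ f : UnitAddTorus (Fin 3) → EuclideanSpace ℝ (Fin 3), Literature.Analysis.FunctionSpaces.Torus.IsSmooth f ∧ Literature.Analysis.FunctionSpaces.Torus.IsDivFree f ∧ Literature.Analysis.FunctionSpaces.Torus.HasZeroMean f ∧ ∃ (ν : ℕ → ℝ) (u : ℕ → UnitAddTorus (Fin 3) → EuclideanSpace ℝ (Fin 3)) (p : ℕ → UnitAddTorus (Fin 3) → ℝ), (∀ j, 0 < ν j) ∧ Filter.Tendsto ν Filter.atTop (nhds 0) ∧ (∀ j, Literature.Analysis.FunctionSpaces.Torus.IsClassicalNSSolutionOn Set.univ (ν j) (fun _ => f) (fun _ => u j) (fun _ => p j)) ∧ (∃ E : ℝ, ∀ j, MeasureTheory.integral MeasureTheory.volume (fun x => ‖u j x‖ ^ 2) ≤ E) ∧ (∃ A : ℝ, ∀ j x (i : Fin 3), ‖Literature.Analysis.FunctionSpaces.Torus.partialDeriv i (u j) x‖ ≤ A / Real.sqrt (ν j)) ∧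 ∃ ε : ℝ, 0 < ε ∧ ∀ j, ε ≤ ν j * Literature.Analysis.FunctionSpaces.Torus.gradNormSq (u j)

/-- item stmt-AnomalousDissipation-0221 · support · rank 9 · closed · proved by Summit.AnomalousDissipation.AnomalousDissipation.Theorems.SteadyBoundedBranch_proof @ 8521145e4bc5 (prover) · by planner
A steady solution branch escaping the laminar scaling ‖u‖ ~ ν⁻¹. If u_j were also H¹-bounded then
(f,u_j) = ν_j‖∇u_j‖² → 0 and u_j → steady forced Euler state with f ⊥ u; otherwise #2.
Bifurcation/continuation in ν; degree theory gives existence but no selection. -/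
@[route_item "route-AnomalousDissipation-FrozenK41"]
def SteadyBoundedBranch : Prop :=
  ∃ f : UnitAddTorus (Fin 3) → EuclideanSpace ℝ (Fin 3), Literature.Analysis.FunctionSpaces.Torus.IsSmooth f ∧ Literature.Analysis.FunctionSpaces.Torus.IsDivFree f ∧ Literature.Analysis.FunctionSpaces.Torus.HasZeroMean f ∧ f ≠ 0 ∧ ∃ (ν : ℕ → ℝ) (u : ℕ → UnitAddTorus (Fin 3) → EuclideanSpace ℝ (Fin 3)) (p : ℕ → UnitAddTorus (Fin 3) → ℝ), (∀ j, 0 < ν j) ∧ Filter.Tendsto ν Filter.atTop (nhds 0) ∧ (∀ j, Literature.Analysis.FunctionSpaces.Torus.IsClassicalNSSolutionOn Set.univ (ν j) (fun _ => f) (fun _ => u j) (fun _ => p j)) ∧ ∃ E : ℝ, ∀ j, MeasureTheory.integral MeasureTheory.volume (fun x => ‖u j x‖ ^ 2) ≤ E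

/-- `SteadyBoundedBranch` holds: proved by `Summit.AnomalousDissipation.AnomalousDissipation.Theorems.SteadyBoundedBranch_proof` @ 8521145e4bc5. -/
theorem SteadyBoundedBranch_holds : SteadyBoundedBranch := _root_.Summit.AnomalousDissipation.AnomalousDissipation.Theorems.SteadyBoundedBranch_proof

/-- item stmt-AnomalousDissipation-14306 · support · rank 9 · open · by planner
sources: Temam1979 Ch. II (1.21)-(1.22) (steady energy equation), DoeringFoias2002 §2 eq. (2.4), decl Literature.Analysis.FluidPDE.Torus.tendsto_integral_inner_of_tendsto_lintegral_sub_sq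
[support] [glue] FrozenStandingCascade → SteadyWitness (the consequent is the target
stmt-AnomalousDissipation-0219 by decl name). PROVED in the planner's scratch file GlueProof.lean
(≈60 lines, axioms propext/Classical.choice/Quot.sound; attached as evidence on this item) — a
prover only has to transplant it to Theorems/: (i) steady budget ν·gradNormSq u = ∫⟪f,u⟫ for a
time-constant classical solution: Torus.IsClassicalNSSolutionOn.energy_balance_holds h convex_univ
(t := 0) gives a HasDerivWithinAt of the constant s ↦ kineticEnergy u within univ; .hasDerivAt
univ_mem, hasDerivAt_const and HasDerivAt.unique, linarith; (ii) MemLp (u j) 2 from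
(h.smooth_velocity.isSmooth_slice (mem_univ 0)).memLp 2; ∫⁻‖u j − U‖ₑ^2 → 0 from eLpNorm → 0 via
ENNReal.continuous_rpow_const, eLpNorm_nnreal_pow_eq_lintegral (p = 2) and ENNReal.rpow_ofNat; then
Literature.Analysis.FluidPDE.tendsto_integral_inner_of_tendsto_lintegral_sub_sq
(SteadyNavierStokesWeakForm) with hf.memLp 2 gives ν_j·gradNormSq (u j) → c := ∫⟪f,U⟫
(Tendsto.congr' with (i)); (iii) hlim.eventually (Ici_mem_nhds (c/2 < c)) + eventually_atTop give J;
witnesses (f, ν ∘ (·+J), u ∘ (·+J), p ∘ (·+J), E, ε := c/2) with hν0.comp (tendsto_ad -/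
@[route_item "route-AnomalousDissipation-FrozenK41"]
def FrozenGlue : Prop :=
  FrozenStandingCascade → SteadyWitness

/-- item stmt-AnomalousDissipation-14359 · support · rank 9 · open · by planner
[support] [glue] K41RegularSteadyWitness → SteadyWitness: drop the gradient-cap conjunct (rintro
⟨f,hf,hdiv,hmean,ν,u,p,hν,hν0,hsol,hE,_,hε⟩; exact ⟨…⟩ — 2 lines, checked rc 0 in the planner's
Sketch.lean; provable now by anyone idle). Makes the target reachable from a crux (D-0019/A11 badge
route.target-unreachable) and, with Assembly, gives the deciding chain #5 → Target →
AnomalousDissipation used by `closes`. [deps: K41RegularSteadyWitness, SteadyWitness] [difficulty: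
provable-now] -/
@[route_item "route-AnomalousDissipation-FrozenK41"]
def K41RegularImpliesSteady : Prop :=
  K41RegularSteadyWitness → SteadyWitness

/-- item stmt-AnomalousDissipation-1213 · assembly · rank 1 · open · by planner
[assembly] SteadyWitness → AnomalousDissipation. Proof map (glue, ≤ 120 lines, provable now): from
the witness take τ_j := 1 and the time-constant fields (fun _ => u j), (fun _ => p j) (a steady
classical solution on univ is 1-periodic); meanEnergy (fun _ => u j) = ∫‖u j x‖² (timeMean of a
constant is the constant for T > 0, limsup of an eventually constant function; cf. proved
Literature.Turb.tendsto_timeMean_of_periodic in Theorems/EulerLimitCesaro, or direct) ≤ E;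
meanDissipation (ν j) (fun _ => u j) = ν_j·(eGradNormSq (u j)).toReal = ν_j·gradNormSq (u j) by the
DISCHARGED fact Torus.gradNormSq_eq_toReal_eGradNormSq_holds (TorusFourierCalculus) on the smooth
slice (IsClassicalNSSolutionOn.smooth_velocity) ≥ ε; then apply Theorems/CoherentStatesAssembly
`AnomalousDissipation.CoherentStates.coherent_assembly_fact` to the discharged fact
Torus.isGlobalLerayHopf_of_isClassicalNSSolutionOn_holds (TorusClassicalLerayHopfProofs:353) and the
CoherentThesis witness ⟨f, ν, τ, u, p⟩. Imports:
Summits.AnomalousDissipation.AnomalousDissipation.Theorems.CoherentStatesAssembly,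
Literature.Analysis.FluidPDE.TorusClassicalLerayHopfProofs,
Literature.Analysis.FunctionSpaces.TorusFourierCalculus, -/
@[route_item "route-AnomalousDissipation-FrozenK41", crux]
def Assembly : Prop :=
  SteadyWitness → AnomalousDissipation

/-! D-0027 §2.1 — DECIDING THEOREM (planner-authored via `route open/edit --closes-file`; by planner-rchoice-AnomalousDissipation-FrozenK41-88655419-0 2026-08-16T03:27:27Z):
its hypotheses are this route's items and its conclusion the sub-problem Statement (glue_lint), and it elaborates with this file. -/

@[closes "route-AnomalousDissipation-FrozenK41"] theorem closes (hW : SteadyWitness) (hA : Assembly) : _root_.AnomalousDissipation :=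
  hA hW

end Summit.AnomalousDissipation.AnomalousDissipation.Theses.FrozenK41
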